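import Summits.CriticalPhenomena.PercolationContinuityZ3.Theorems.PercNearOneGluingNoHeavyLowerTailOneLayerFullGraphChampion
import Summits.CriticalPhenomena.PercolationContinuityZ3.Theorems.PercNearOneGluingNoHeavyLowerTailConditionedChampionExchange
import Literature.Probability.LatticeModels.ProdBernoulliIndependence
import HarnessLib

/-!
# `NoHeavyLowerTail` (stmt-CriticalPhenomena-4575) — the restricted-attachment exchange REX for every observer
# SUPPORTED ON `Q ∪ {q}` (all its positive-weight neighbours lie in `Q ∪ {q}`), any `|Q|`, any level

Support file (lemma factory #8 `prim-lf-8`, gen 10; `--supports stmt-CriticalPhenomena-4575`).  No definitions, no named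
facts, no sorries.  `μ = prodBernoulli w` on `Fin n`, relays `A`, level `j`, `π(v) = {a ∈ A : v ↔ a}`, `N = |π(o)|`,
`L_v = {|π(v)| ≤ j}`, `H_v = {|π(v)| > j}`, `U = {o ↔ Q} = ⋃_{x ∈ Q} {o ↔ x}`, `S(v) = μ(L_v)`.

**REX** (restricted-attachment exchange, the typed hypothesis of `RestrictedAttachmentExchange.noHeavyLowerTail_of_rex`; equal
to the small-block transfer `(T)` of `…SmallBlockTransfer.lean` after adding the common event): for `q ∈ A`, `Q ⊆ A ∖ q` beaten by
`q` (`S(x) ≤ S(q)`, `x ∈ Q`) and `o ∉ A`:  `μ(U, 1 ≤ N ≤ j, H_q) ≤ μ(U, H_o, L_q)`.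

* `SupportedObserverExchange.rex_of_supported` — **REX holds for every observer `o ∉ A` all of whose positive-weight
  neighbours lie in `Q ∪ {q}`**, for every `|Q|`, every level and every weighted graph behind the neighbours, and already
  when `q` beats only the PORTS of `o` in `Q` (the members `x ∈ Q` with `w s(o,x) ≠ 0`).  This contains the two-port theorem
  `TwoPortExchange.twoPort_rex` (`|Q| = 2`, `o` adjacent exactly to the two members of `Q`; gen 9, three files) as the
  smallest case, and settles the "m-port observer" question of the gen-9 hand-off (REX2-NOTE-gen9 §5) for all `m`.
  Proof: for such an observer `{o ↔ A} = U ∪ {o ↔ q}` almost surely (the first open edge of a path from `o` ends in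
  `Q ∪ {q}`), and on `{o ↔ q}` the blocks of `o` and `q` coincide; so REX is the one-layer pre-FKG transfer
  `μ(1 ≤ N ≤ j) ≤ μ(o ↔ A, L_q)` of `OneLayerFull.lowerTail_le_inter_of_beatsPorts` (Kozma–Nitzan's Lemma 5 / Theorem 8
  star decomposition with the port maximising the observer-deleted lightness, then the full-graph comparison) for the
  witness `q`, which beats every port (the ports lie in `Q ∪ {q}`).
* `SupportedObserverExchange.rex_of_supported'` — the same with the plain REX hypothesis "`q` beats `Q`".
What is NOT here: observers with a positive-weight neighbour outside `Q ∪ {q}` (a Steiner vertex or a relay of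
`A ∖ (Q ∪ q)`); for those REX is Kozma–Nitzan's Conjecture 4 territory (CANDIDATES v10).
-/

noncomputable section

namespace Summit.CriticalPhenomena.PercolationContinuityZ3.Theorems

open MeasureTheory Set Literature.Probability.LatticeModels Literature.Probability.Percolation
open scoped Classical BigOperators

variable {n : ℕ}

namespace SupportedObserverExchange

/-- The configurations with an open pair `s(o,u)` towards a vertex `u ∉ P`, `u ≠ o`, form a null event when all such pairs
have weight `0` (union bound over the one-coordinate marginals `μ{e ∈ ω} = w e`). [folklore] -/
theorem real_exists_open_outside_eq_zero (w : Sym2 (Fin n) → unitInterval) (o : Fin n) (P : Finset (Fin n))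
    (hsupp : ∀ u : Fin n, u ≠ o → u ∉ P → w s(o, u) = 0) :
    (prodBernoulli w).real {ω : BondConfig (Fin n) | ∃ u : Fin n, u ≠ o ∧ u ∉ P ∧ s(o, u) ∈ ω} = 0 := by
  set F : Finset (Sym2 (Fin n)) := (Finset.univ.filter fun u : Fin n => u ≠ o ∧ u ∉ P).image fun u => s(o, u) with hF
  have hsub : {ω : BondConfig (Fin n) | ∃ u : Fin n, u ≠ o ∧ u ∉ P ∧ s(o, u) ∈ ω} ⊆
      {ω : BondConfig (Fin n) | ∃ e ∈ F, e ∈ ω} := by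
    rintro ω ⟨u, huo, huP, hu⟩
    exact ⟨s(o, u), Finset.mem_image.2 ⟨u, Finset.mem_filter.2 ⟨Finset.mem_univ u, huo, huP⟩, rfl⟩, hu⟩
  have hsum : ∑ e ∈ F, ((w e : unitInterval) : ℝ) = 0 := by
    refine Finset.sum_eq_zero fun e he => ?_
    obtain ⟨u, hu, rfl⟩ := Finset.mem_image.1 he
    obtain ⟨-, huo, huP⟩ := Finset.mem_filter.1 hu
    rw [hsupp u huo huP]; rfl
  refine le_antisymm ?_ measureReal_nonneg
  calc (prodBernoulli w).real {ω : BondConfig (Fin n) | ∃ u : Fin n, u ≠ o ∧ u ∉ P ∧ s(o, u) ∈ ω}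
      ≤ (prodBernoulli w).real {ω : BondConfig (Fin n) | ∃ e ∈ F, e ∈ ω} :=
        measureReal_mono hsub (measure_ne_top _ _)
    _ ≤ ∑ e ∈ F, ((w e : unitInterval) : ℝ) := prodBernoulli_real_exists_mem_le_sum w F
    _ = 0 := hsum

/-- **First-edge lemma.**  If every open pair at `o` goes into `P`, then an open path from `o` to a vertex `a ≠ o` starts with an
open pair `s(o,u)`, `u ∈ P`, so `o ↔ u` for some `u ∈ P`. [folklore] -/
theorem exists_mem_openConn_of_openConn {ω : BondConfig (Fin n)} {o a : Fin n} (P : Finset (Fin n))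
    (hgood : ∀ u : Fin n, u ≠ o → u ∉ P → s(o, u) ∉ ω) (hao : a ≠ o)
    (h : ω ∈ (openConn o a : Set (BondConfig (Fin n)))) :
    ∃ u ∈ P, ω ∈ (openConn o u : Set (BondConfig (Fin n))) := by
  have h' : (openGraph ω).Reachable o a := h
  obtain ⟨p⟩ := h'
  cases p with
  | nil => exact absurd rfl hao
  | @cons _ u _ hadj _ =>
    have hou := (openGraph_adj ω o u).1 hadj
    have huP : u ∈ P := by
      by_contra huP
      exact hgood u (Ne.symm hou.2) huP hou.1
    exact ⟨u, huP, hadj.reachable⟩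

/-- **REX for observers supported on `Q ∪ {q}`, port form.**  Let `o ∉ A`, `q ∈ A`, `Q ⊆ A ∖ q`, and suppose every
positive-weight neighbour of `o` lies in `Q ∪ {q}` and `q` beats every port of `o` in `Q` (`S(x) ≤ S(q)` whenever `x ∈ Q`,
`w s(o,x) ≠ 0`).  Then `μ(U ∩ {1 ≤ N ≤ j} ∩ H_q) ≤ μ(U ∩ H_o ∩ L_q)`, `U = {o ↔ Q}`.  (One-layer pre-FKG transfer of
`OneLayerFull.lowerTail_le_inter_of_beatsPorts` for the witness `q` + `{o ↔ A} = U ∪ {o ↔ q}` a.s.) [this work] -/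
theorem rex_of_supported (w : Sym2 (Fin n) → unitInterval) (A Q : Finset (Fin n)) (o q : Fin n) (j : ℕ)
    (ho : o ∉ A) (hq : q ∈ A) (hQ : Q ⊆ A.erase q)
    (hsupp : ∀ u : Fin n, u ≠ o → w s(o, u) ≠ 0 → u ∈ Q ∨ u = q)
    (hbeat : ∀ x ∈ Q, w s(o, x) ≠ 0 →
      (prodBernoulli w).real {ω : BondConfig (Fin n) | (A.filter fun a => ω ∈ openConn x a).card ≤ j} ≤
        (prodBernoulli w).real {ω : BondConfig (Fin n) | (A.filter fun a => ω ∈ openConn q a).card ≤ j}) :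
    (prodBernoulli w).real ((⋃ x ∈ Q, (openConn o x : Set (BondConfig (Fin n)))) ∩
        {ω | 1 ≤ (A.filter fun a => ω ∈ openConn o a).card ∧ (A.filter fun a => ω ∈ openConn o a).card ≤ j} ∩
        {ω | j < (A.filter fun a => ω ∈ openConn q a).card}) ≤
      (prodBernoulli w).real ((⋃ x ∈ Q, (openConn o x : Set (BondConfig (Fin n)))) ∩
        {ω | j < (A.filter fun a => ω ∈ openConn o a).card} ∩
        {ω | (A.filter fun a => ω ∈ openConn q a).card ≤ j}) := by
  set μ := prodBernoulli w with hμ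
  set U : Set (BondConfig (Fin n)) := ⋃ x ∈ Q, (openConn o x : Set (BondConfig (Fin n))) with hU
  set 𝔸 : Set (BondConfig (Fin n)) := ⋃ a ∈ A, (openConn o a : Set (BondConfig (Fin n))) with h𝔸
  set L1 : Set (BondConfig (Fin n)) := {ω | 1 ≤ (A.filter fun a => ω ∈ openConn o a).card ∧
    (A.filter fun a => ω ∈ openConn o a).card ≤ j} with hL1
  set Lo : Set (BondConfig (Fin n)) := {ω | (A.filter fun a => ω ∈ openConn o a).card ≤ j} with hLo
  set Ho : Set (BondConfig (Fin n)) := {ω | j < (A.filter fun a => ω ∈ openConn o a).card} with hHo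
  set Lq : Set (BondConfig (Fin n)) := {ω | (A.filter fun a => ω ∈ openConn q a).card ≤ j} with hLq
  set Hq : Set (BondConfig (Fin n)) := {ω | j < (A.filter fun a => ω ∈ openConn q a).card} with hHq
  set Bd : Set (BondConfig (Fin n)) := {ω | ∃ u : Fin n, u ≠ o ∧ u ∉ insert q Q ∧ s(o, u) ∈ ω} with hBd
  have hmeas : ∀ s : Set (BondConfig (Fin n)), MeasurableSet s := fun _ => MeasurableSet.of_discrete
  have hnn : ∀ s : Set (BondConfig (Fin n)), 0 ≤ μ.real s := fun _ => measureReal_nonneg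
  have mono : ∀ {s t : Set (BondConfig (Fin n))}, s ⊆ t → μ.real s ≤ μ.real t :=
    fun h => measureReal_mono h (measure_ne_top μ _)
  have hqo : q ≠ o := fun h => ho (h ▸ hq)
  have hQA : ∀ x ∈ Q, x ∈ A := fun x hx => Finset.mem_of_mem_erase (hQ hx)
  -- the observer is one-layer and `q` beats every port
  have hiso : ∀ u, u ≠ o → u ∉ A → w s(o, u) = 0 := by
    intro u huo huA
    by_contra h0
    rcases hsupp u huo h0 with h | h
    · exact huA (hQA u h)
    · exact huA (h ▸ hq)
  have hbeat' : ∀ v ∈ A, w s(o, v) ≠ 0 →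
      μ.real {ω : BondConfig (Fin n) | (A.filter fun y => ω ∈ openConn v y).card ≤ j} ≤
        μ.real {ω : BondConfig (Fin n) | (A.filter fun y => ω ∈ openConn q y).card ≤ j} := by
    intro v hv hv0
    rcases hsupp v (fun h => ho (h ▸ hv)) hv0 with h | h
    · exact hbeat v h hv0
    · rw [h]
  have key := OneLayerFull.lowerTail_le_inter_of_beatsPorts w A o q j ho hq hiso hbeat'
  change μ.real L1 ≤ μ.real (𝔸 ∩ Lq) at key
  -- `L1 = 𝔸 ∩ Lo`
  have eL1 : L1 = 𝔸 ∩ Lo := by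
    ext ω
    simp only [hL1, h𝔸, hLo, mem_inter_iff, mem_setOf_eq, mem_iUnion, exists_prop]
    constructor
    · rintro ⟨h1, hle⟩
      obtain ⟨a, ha⟩ := Finset.card_pos.1 (by omega : 0 < (A.filter fun x => ω ∈ openConn o x).card)
      rw [Finset.mem_filter] at ha
      exact ⟨⟨a, ha.1, ha.2⟩, hle⟩
    · rintro ⟨⟨a, ha, hωa⟩, hle⟩
      exact ⟨Finset.card_pos.2 ⟨a, Finset.mem_filter.2 ⟨ha, hωa⟩⟩, hle⟩
  rw [eL1] at key
  -- cancel the common part `𝔸 ∩ Lo ∩ Lq`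
  have e1 : μ.real (𝔸 ∩ Lo) = μ.real (𝔸 ∩ Lo ∩ Hq) + μ.real ((𝔸 ∩ Lo) \ Hq) :=
    (measureReal_inter_add_sdiff (μ := μ) (s := 𝔸 ∩ Lo) (t := Hq) (hmeas _)).symm
  have e2 : μ.real (𝔸 ∩ Lq) = μ.real (𝔸 ∩ Lq ∩ Ho) + μ.real ((𝔸 ∩ Lq) \ Ho) :=
    (measureReal_inter_add_sdiff (μ := μ) (s := 𝔸 ∩ Lq) (t := Ho) (hmeas _)).symm
  have e3 : (𝔸 ∩ Lo) \ Hq = (𝔸 ∩ Lq) \ Ho := by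
    ext ω; simp only [mem_sdiff, mem_inter_iff, h𝔸, hLo, hLq, hHo, hHq, mem_setOf_eq, not_lt]; tauto
  have key2 : μ.real (𝔸 ∩ Lo ∩ Hq) ≤ μ.real (𝔸 ∩ Lq ∩ Ho) := by
    rw [e3] at e1; linarith
  -- the null event of an open pair towards a vertex outside `Q ∪ {q}`
  have hBd0 : μ.real Bd = 0 := by
    have := real_exists_open_outside_eq_zero w o (insert q Q) (fun u huo huP => by
      by_contra h0
      rcases hsupp u huo h0 with h | h
      · exact huP (Finset.mem_insert_of_mem h)
      · exact huP (h ▸ Finset.mem_insert_self q Q))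
    simpa only [hBd] using this
  -- inclusions
  have i1 : U ∩ L1 ∩ Hq ⊆ 𝔸 ∩ Lo ∩ Hq := by
    rintro ω ⟨⟨hUω, -, hle⟩, hh⟩
    refine ⟨⟨?_, hle⟩, hh⟩
    rw [hU] at hUω
    obtain ⟨x, hx, hωx⟩ := mem_iUnion₂.1 hUω
    exact mem_biUnion (hQA x hx) hωx
  have i2 : 𝔸 ∩ Lq ∩ Ho ⊆ (U ∩ Ho ∩ Lq) ∪ Bd := by
    rintro ω ⟨⟨h𝔸ω, hl⟩, hh⟩
    by_cases hbad : ω ∈ Bd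
    · exact Or.inr hbad
    refine Or.inl ⟨⟨?_, hh⟩, hl⟩
    have hgood : ∀ u : Fin n, u ≠ o → u ∉ insert q Q → s(o, u) ∉ ω := by
      intro u huo huP hu
      exact hbad ⟨u, huo, huP, hu⟩
    rw [h𝔸] at h𝔸ω
    obtain ⟨a, ha, hωa⟩ := mem_iUnion₂.1 h𝔸ω
    have hao : a ≠ o := fun h => ho (h ▸ ha)
    obtain ⟨u, hu, hωu⟩ := exists_mem_openConn_of_openConn (insert q Q) hgood hao hωa
    rcases Finset.mem_insert.1 hu with huq | huQ
    · -- `o ↔ q`: the blocks of `o` and `q` coincide, contradicting `H_o ∩ L_q`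
      exfalso
      rw [huq] at hωu
      have e := ConditionedChampionExchange.filter_eq_of_openConn A hωu
      have hh' : j < (A.filter fun a => ω ∈ openConn o a).card := hh
      have hl' : (A.filter fun a => ω ∈ openConn q a).card ≤ j := hl
      rw [e] at hh'
      exact absurd hl' (not_le.2 hh')
    · exact mem_biUnion huQ hωu
  calc μ.real (U ∩ L1 ∩ Hq)
      ≤ μ.real (𝔸 ∩ Lo ∩ Hq) := mono i1
    _ ≤ μ.real (𝔸 ∩ Lq ∩ Ho) := key2
    _ ≤ μ.real ((U ∩ Ho ∩ Lq) ∪ Bd) := mono i2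
    _ ≤ μ.real (U ∩ Ho ∩ Lq) + μ.real Bd := measureReal_union_le _ _
    _ = μ.real (U ∩ Ho ∩ Lq) := by rw [hBd0, add_zero]

/-- **REX for observers supported on `Q ∪ {q}`** (the typed REX hypothesis shape of
`RestrictedAttachmentExchange.noHeavyLowerTail_of_rex`, restricted to supported observers): `o ∉ A`, `q ∈ A`, `Q ⊆ A ∖ q`
beaten by `q`, every positive-weight neighbour of `o` in `Q ∪ {q}` ⇒ `μ(U, 1 ≤ N ≤ j, H_q) ≤ μ(U, H_o, L_q)`.
Contains `TwoPortExchange.twoPort_rex`. [this work] -/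
theorem rex_of_supported' (w : Sym2 (Fin n) → unitInterval) (A Q : Finset (Fin n)) (o q : Fin n) (j : ℕ)
    (ho : o ∉ A) (hq : q ∈ A) (hQ : Q ⊆ A.erase q)
    (hsupp : ∀ u : Fin n, u ≠ o → w s(o, u) ≠ 0 → u ∈ Q ∨ u = q)
    (hbeat : ∀ x ∈ Q,
      (prodBernoulli w).real {ω : BondConfig (Fin n) | (A.filter fun a => ω ∈ openConn x a).card ≤ j} ≤
        (prodBernoulli w).real {ω : BondConfig (Fin n) | (A.filter fun a => ω ∈ openConn q a).card ≤ j}) :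
    (prodBernoulli w).real ((⋃ x ∈ Q, (openConn o x : Set (BondConfig (Fin n)))) ∩
        {ω | 1 ≤ (A.filter fun a => ω ∈ openConn o a).card ∧ (A.filter fun a => ω ∈ openConn o a).card ≤ j} ∩
        {ω | j < (A.filter fun a => ω ∈ openConn q a).card}) ≤
      (prodBernoulli w).real ((⋃ x ∈ Q, (openConn o x : Set (BondConfig (Fin n)))) ∩
        {ω | j < (A.filter fun a => ω ∈ openConn o a).card} ∩
        {ω | (A.filter fun a => ω ∈ openConn q a).card ≤ j}) :=
  rex_of_supported w A Q o q j ho hq hQ hsupp fun x hx _ => hbeat x hx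

end SupportedObserverExchange

end Summit.CriticalPhenomena.PercolationContinuityZ3.Theorems

end
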